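import Literature.MathematicalPhysics.KineticTheory.DiPernaLionsLimit
import Literature.Analysis.FluidPDE.BoltzmannEquationProofs
import HarnessLib

/-!
# The DiPerna–Lions weak limit: proofs

Topic: MathematicalPhysics / KineticTheory. Discharge of the named fact (D5)
`Kinetic.renormalisedIdentity_of_isAEMildSolution` of
`Literature.MathematicalPhysics.KineticTheory.DiPernaLionsLimit` — Cercignani–Illner–Pulvirenti
1994 §5.3 Lemma 5.3.4 (ii) (p. 144) with its Appendix 5.A (pp. 164–166): *an a.e. mild solution of
the Boltzmann equation with `Q±(f,f)/(1+f) ∈ L¹_loc` satisfies the renormalised equation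
`(∂ₜ + v·∇ₓ) log (1 + f) = Q(f,f)/(1+f)` in `𝒟'((0,∞) × E × E)`* —
as `Kinetic.renormalisedIdentity_of_isAEMildSolution_holds`.

The printed proof (Thm 5.A.1: `Tf = h` in `𝒟'` iff `f♯` is absolutely continuous along almost
every characteristic with derivative `h♯`; then the chain rule for the Lipschitz function
`ln (1 + ·)`) is organised as follows.

* `Kinetic.integral_Ioi_primitive_mul_deriv`: the one-dimensional integration by parts
  `∫₀^∞ (c + ∫₀ᵗ η) ρ' dt = -∫₀^∞ η ρ` for `η ∈ L¹` and a `C¹` test function `ρ` (Fubini on the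
  triangle `0 < s ≤ t`), which is the converse half of Thm 5.A.1 along one characteristic;
* `Kinetic.log_one_add_primitive_eq`: the chain rule `log (1 + F(t)) = log (1 + F(0)) +
  ∫₀ᵗ F'/(1 + F)` for a nonnegative primitive `F = c + ∫₀ᵗ η`, `η ∈ L¹`, proved by approximating
  `η` in `L¹` by continuous functions (Mathlib's density theorem) and the classical fundamental
  theorem of calculus;
* `Kinetic.nonneg_of_ae_nonneg_of_continuousOn`: a continuous function which is a.e. nonnegative
  on an interval is nonnegative;
* `Kinetic.measurePreserving_freeShear`, `Kinetic.shearFlow`, `Kinetic.measurePreserving_shearFlow`: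
  the free-flow change of coordinates `(t, x, v) ↦ (t, x + t v, v)` preserves Lebesgue measure on
  `E × E` and on `ℝ × E × E` (skew products of translations), so that integrals over
  `(0,∞) × E × E` can be computed characteristic by characteristic
  (`Kinetic.integral_eq_integral_integral_shearFlow`);
* `Kinetic.measurable_gainWith_param`, `Kinetic.measurable_lossWith_param`,
  `Kinetic.collisionOpWith_eq_gainWith_sub_lossWith_holds` (discharge of the prelude's named
  fact `Kinetic.collisionOpWith_eq_gainWith_sub_lossWith`, CIP 1994 (3.1.11)): measurability of
  the collision functionals of a measurable density and `Q = Q⁺ - Q⁻` at points of absolute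
  convergence;
* `Kinetic.deriv_add_fderiv_eq_fderiv`, `Kinetic.hasDerivAt_comp_characteristic`,
  `Kinetic.IsKineticTest.exists_support_bounds`: calculus of kinetic test functions
  (`∂ₜφ + v·∇ₓφ` is the derivative along characteristics; compact support in `[a, b] × B_R`,
  `a > 0`);
* `Kinetic.renormalisedIdentity_of_isAEMildSolution_holds`: the pairing
  `∫∫∫ [log(1+f) Tφ + (Q(f,f)/(1+f)) φ]` is written as an integral over `(0,∞) × E × E`, moved to
  free-flow coordinates, and computed along almost every characteristic, where Duhamel's formula
  (a.e. in `(x,v)` for each `t`, upgraded to a joint a.e. statement by measurability) exhibits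
  `f♯` as the nonnegative primitive `f(0) + ∫₀ᵗ Q(f,f)♯`.

## References

* C. Cercignani, R. Illner, M. Pulvirenti, *The Mathematical Theory of Dilute Gases*, Springer
  (1994), §5.3 Def. 5.3.2, Lemma 5.3.4 (pp. 143–144), Appendix 5.A, Thm 5.A.1 (pp. 164–166).
* R. J. DiPerna, P.-L. Lions, *On the Cauchy problem for Boltzmann equations: global existence and
  weak stability*, Ann. of Math. 130 (1989) 321–366 (smooth/mild solutions are renormalised,
  p. 322).
-/

open MeasureTheory Metric Real Set Filter Topology
open scoped InnerProductSpace ENNReal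

noncomputable section

namespace Literature.MathematicalPhysics.KineticTheory

/-! ## One-dimensional lemmas along characteristics -/

section OneD

/-- A continuous function which is almost everywhere nonnegative on `(a, b)` is nonnegative on
`[a, b]`. [folklore] -/
theorem nonneg_of_ae_nonneg_of_continuousOn {F : ℝ → ℝ} {a b : ℝ} (hab : a < b)
    (hF : ContinuousOn F (Icc a b)) (hae : ∀ᵐ t ∂(volume.restrict (Ioo a b)), 0 ≤ F t) :
    ∀ t ∈ Icc a b, 0 ≤ F t := by
  by_contra hcon
  push Not at hcon
  obtain ⟨t₀, ht₀, hneg⟩ := hcon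
  have hct : ContinuousWithinAt F (Icc a b) t₀ := hF t₀ ht₀
  have hev : ∀ᶠ t in 𝓝[Icc a b] t₀, F t < 0 := hct.eventually (gt_mem_nhds hneg)
  rcases Metric.mem_nhdsWithin_iff.1 hev with ⟨ε, hε, hball⟩
  have hsub : Ioo a b ∩ Metric.ball t₀ ε ⊆ {t | F t < 0} := fun t ht =>
    hball ⟨ht.2, Ioo_subset_Icc_self ht.1⟩
  have hpos : 0 < volume (Ioo a b ∩ Metric.ball t₀ ε) := by
    have hopen : IsOpen (Ioo a b ∩ Metric.ball t₀ ε) := isOpen_Ioo.inter Metric.isOpen_ball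
    have hne : (Ioo a b ∩ Metric.ball t₀ ε).Nonempty := by
      have : t₀ ∈ closure (Ioo a b) := by
        rw [closure_Ioo hab.ne]; exact ht₀
      exact (mem_closure_iff_nhds.1 this) _ (Metric.ball_mem_nhds t₀ hε) |>.imp
        fun t ht => ⟨ht.2, ht.1⟩
    exact hopen.measure_pos volume hne
  have hzero : volume.restrict (Ioo a b) {t | ¬ 0 ≤ F t} = 0 := ae_iff.1 hae
  rw [Measure.restrict_apply' measurableSet_Ioo] at hzero
  have : volume (Ioo a b ∩ Metric.ball t₀ ε) ≤ volume ({t | ¬ 0 ≤ F t} ∩ Ioo a b) :=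
    measure_mono fun t ht => ⟨by simpa using hsub ht, ht.1⟩
  exact absurd (hzero ▸ this) (not_le.2 hpos)

/-- Integration by parts for primitives against test functions (the computation behind CIP 1994
Thm 5.A.1, Appendix 5.A p. 164: multiply `f♯(t₂) - f♯(t₁) = ∫ h♯` by `ρ'(t)` and integrate):
if `η ∈ L¹((0, b])`, `ρ ∈ C¹(ℝ)` with `ρ = ρ' = 0` on `[b, ∞)` and `ρ(0) = 0`, then
`∫₀^∞ (c + ∫₀ᵗ η) ρ'(t) dt = -∫₀^∞ η ρ` (Fubini on the triangle `0 < s ≤ t ≤ b`). [cite: CIPDiluteGases1994, Appendix 5.A Thm 5.A.1 (p. 164)] -/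
theorem integral_Ioi_primitive_mul_deriv {η ρ ρ' : ℝ → ℝ} {c b : ℝ} (hb : 0 < b)
    (hη : IntegrableOn η (Ioc 0 b)) (hρ : ∀ t, HasDerivAt ρ (ρ' t) t) (hρ' : Continuous ρ')
    (hρb : ∀ t, b ≤ t → ρ t = 0) (hρ'b : ∀ t, b ≤ t → ρ' t = 0) (hρ0 : ρ 0 = 0) :
    ∫ t in Ioi 0, (c + ∫ s in Ioc 0 t, η s) * ρ' t = -∫ t in Ioi 0, η t * ρ t := by
  -- Step 0: restrict both integrals to `(0, b]`
  have hL : ∫ t in Ioi 0, (c + ∫ s in Ioc 0 t, η s) * ρ' t =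
      ∫ t in Ioc 0 b, (c + ∫ s in Ioc 0 t, η s) * ρ' t := by
    refine setIntegral_eq_of_subset_of_forall_sdiff_eq_zero measurableSet_Ioi Ioc_subset_Ioi_self
      fun t ht => ?_
    have : b ≤ t := by
      rcases ht with ⟨h1, h2⟩
      simp only [mem_Ioc, not_and, not_le] at h2
      exact (h2 h1).le
    simp [hρ'b t this]
  have hR : ∫ t in Ioi 0, η t * ρ t = ∫ t in Ioc 0 b, η t * ρ t := by
    refine setIntegral_eq_of_subset_of_forall_sdiff_eq_zero measurableSet_Ioi Ioc_subset_Ioi_self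
      fun t ht => ?_
    have : b ≤ t := by
      rcases ht with ⟨h1, h2⟩
      simp only [mem_Ioc, not_and, not_le] at h2
      exact (h2 h1).le
    simp [hρb t this]
  rw [hL, hR]
  -- Step 1: the constant term integrates to `c (ρ b - ρ 0) = 0`
  have hρ'int : ∀ u v : ℝ, IntervalIntegrable ρ' volume u v := fun u v =>
    hρ'.intervalIntegrable u v
  have hderiv_int : ∀ u v : ℝ, ∫ t in u..v, ρ' t = ρ v - ρ u := fun u v =>
    intervalIntegral.integral_eq_sub_of_hasDerivAt (fun t _ => hρ t) (hρ'int u v)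
  have h1 : ∫ t in Ioc 0 b, c * ρ' t = 0 := by
    rw [← intervalIntegral.integral_of_le hb.le, intervalIntegral.integral_const_mul, hderiv_int,
      hρb b le_rfl, hρ0]
    simp
  -- Step 2: Fubini on the triangle `{0 < s ≤ t ≤ b}`
  set μ : Measure ℝ := volume.restrict (Ioc 0 b) with hμ
  haveI : IsFiniteMeasure μ := by
    rw [hμ]; exact ⟨by simp [Measure.restrict_apply MeasurableSet.univ]⟩
  set G : ℝ → ℝ → ℝ := fun t s => (Iic t).indicator (fun s => η s * ρ' t) s with hG
  have hGint : Integrable (Function.uncurry G) (μ.prod μ) := by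
    have hprod : Integrable (fun q : ℝ × ℝ => ρ' q.1 * η q.2) (μ.prod μ) :=
      ((hρ'.integrableOn_Icc (a := 0) (b := b)).mono_set Ioc_subset_Icc_self).mul_prod hη
    have hGeq : Function.uncurry G = {q : ℝ × ℝ | q.2 ≤ q.1}.indicator
        (fun q : ℝ × ℝ => ρ' q.1 * η q.2) := by
      funext q
      simp only [Function.uncurry, hG, indicator, mem_Iic, mem_setOf_eq]
      split_ifs <;> ring
    rw [hGeq]
    exact hprod.indicator (measurableSet_le measurable_snd measurable_fst)
  have hinner_s : ∀ t ∈ Ioc 0 b, ∫ s, G t s ∂μ = (∫ s in Ioc 0 t, η s) * ρ' t := by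
    intro t ht
    simp only [hG, hμ]
    rw [integral_indicator measurableSet_Iic, Measure.restrict_restrict measurableSet_Iic,
      integral_mul_const]
    have hset : Iic t ∩ Ioc 0 b = Ioc 0 t := by
      ext s
      simp only [mem_inter_iff, mem_Iic, mem_Ioc]
      constructor
      · rintro ⟨h1, h2, _⟩; exact ⟨h2, h1⟩
      · rintro ⟨h1, h2⟩; exact ⟨h2, h1, h2.trans ht.2⟩
    rw [hset]
  have hinner_t : ∀ s ∈ Ioc 0 b, ∫ t, G t s ∂μ = -(η s * ρ s) := by
    intro s hs
    have hGs : (fun t => G t s) = (Ici s).indicator fun t => η s * ρ' t := by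
      funext t
      simp only [hG, indicator, mem_Iic, mem_Ici]
    rw [hGs, hμ, integral_indicator measurableSet_Ici, Measure.restrict_restrict measurableSet_Ici,
      integral_const_mul]
    have hset : Ici s ∩ Ioc 0 b = Icc s b := by
      ext t
      simp only [mem_inter_iff, mem_Ici, mem_Ioc, mem_Icc]
      constructor
      · rintro ⟨h1, _, h3⟩; exact ⟨h1, h3⟩
      · rintro ⟨h1, h2⟩; exact ⟨h1, hs.1.trans_le h1, h2⟩
    rw [hset, integral_Icc_eq_integral_Ioc, ← intervalIntegral.integral_of_le hs.2, hderiv_int,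
      hρb b le_rfl]
    ring
  have hsplit : ∫ t in Ioc 0 b, (c + ∫ s in Ioc 0 t, η s) * ρ' t =
      (∫ t in Ioc 0 b, c * ρ' t) + ∫ t in Ioc 0 b, (∫ s in Ioc 0 t, η s) * ρ' t := by
    rw [← integral_add]
    · refine integral_congr_ae (ae_of_all _ fun t => by ring)
    · exact ((hρ'.integrableOn_Icc (a := 0) (b := b)).mono_set Ioc_subset_Icc_self).const_mul c
    · have := hGint.integral_prod_left
      refine (this.congr ?_)
      filter_upwards [ae_restrict_mem measurableSet_Ioc] with t ht
      exact hinner_s t ht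
  rw [hsplit, h1, zero_add]
  calc ∫ t in Ioc 0 b, (∫ s in Ioc 0 t, η s) * ρ' t
      = ∫ t, ∫ s, G t s ∂μ ∂μ := by
        refine integral_congr_ae ?_
        filter_upwards [ae_restrict_mem measurableSet_Ioc] with t ht
        exact (hinner_s t ht).symm
    _ = ∫ s, ∫ t, G t s ∂μ ∂μ := integral_integral_swap hGint
    _ = ∫ s, -(η s * ρ s) ∂μ := by
        refine integral_congr_ae ?_
        filter_upwards [ae_restrict_mem measurableSet_Ioc] with s hs
        exact hinner_t s hs
    _ = -∫ t in Ioc 0 b, η t * ρ t := by rw [integral_neg]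

/-- The chain rule for `log (1 + ·)` along a primitive, in integral form (CIP 1994 Appendix 5.A,
proof of Lemma 5.3.4 (ii), p. 166: "`g = ln (1 + f)` satisfies
`g♯(t) - g♯(s) = ∫ₛᵗ (1 + f♯)⁻¹ Q(f,f)♯ dσ`"): if `η ∈ L¹(ℝ)` and `F(t) = c + ∫₀ᵗ η ≥ 0` on
`[0, T]`, then `log (1 + F(t)) = log (1 + c) + ∫₀ᵗ η / (1 + F)` for `t ∈ [0, T]`. Proved by
approximating `η` in `L¹` by continuous functions, the classical fundamental theorem of calculus,
and passage to the limit. [cite: CIPDiluteGases1994, Appendix 5.A, proof of Lemma 5.3.4 (ii) (p. 166)] -/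
theorem log_one_add_primitive_eq {η : ℝ → ℝ} (hη : Integrable η) {c T : ℝ}
    (hF : ∀ t ∈ Icc 0 T, 0 ≤ c + ∫ s in (0 : ℝ)..t, η s) {t : ℝ} (ht : t ∈ Icc 0 T) :
    log (1 + (c + ∫ s in (0 : ℝ)..t, η s)) =
      log (1 + c) + ∫ s in (0 : ℝ)..t, η s / (1 + (c + ∫ r in (0 : ℝ)..s, η r)) := by
  set F : ℝ → ℝ := fun t => c + ∫ s in (0 : ℝ)..t, η s with hFdef
  have hFcont : Continuous F :=
    continuous_const.add (intervalIntegral.continuous_primitive (fun a b => hη.intervalIntegrable) 0)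
  -- approximate `η` in `L¹` by continuous functions
  have happrox : ∀ k : ℕ, ∃ g : ℝ → ℝ, Continuous g ∧ Integrable g ∧
      ∫ x, |η x - g x| ≤ 1 / ((k : ℝ) + 2) := by
    intro k
    obtain ⟨g, hg, hgi⟩ := hη.exists_boundedContinuous_integral_sub_le
      (ε := 1 / ((k : ℝ) + 2)) (by positivity)
    exact ⟨g, g.continuous, hgi, by simpa [Real.norm_eq_abs] using hg⟩
  choose g hgc hgi hgε using happrox
  set ε : ℕ → ℝ := fun k => 1 / ((k : ℝ) + 2) with hεdef
  have hεpos : ∀ k, 0 < ε k := fun k => by positivity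
  have hεle : ∀ k, ε k ≤ 1 / 2 := fun k =>
    one_div_le_one_div_of_le (by norm_num) (by linarith [(Nat.cast_nonneg k : (0 : ℝ) ≤ k)])
  have hεlim : Tendsto ε atTop (𝓝 0) := by
    rw [hεdef]
    refine tendsto_const_nhds.div_atTop ?_
    exact tendsto_natCast_atTop_atTop.atTop_add tendsto_const_nhds
  -- the approximate primitives
  set Fk : ℕ → ℝ → ℝ := fun k t => c + ∫ s in (0 : ℝ)..t, g k s with hFkdef
  have hFk_deriv : ∀ k t, HasDerivAt (Fk k) (g k t) t := fun k t => by
    have := intervalIntegral.integral_hasDerivAt_right ((hgi k).intervalIntegrable (a := 0) (b := t))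
      ((hgc k).stronglyMeasurableAtFilter _ _) (hgc k).continuousAt
    simpa [hFkdef] using this.const_add c
  have hFk_cont : ∀ k, Continuous (Fk k) := fun k =>
    continuous_iff_continuousAt.2 fun t => (hFk_deriv k t).continuousAt
  -- uniform closeness `|Fk k t - F t| ≤ ε k` for `t ≥ 0`
  have hclose : ∀ k, ∀ t, 0 ≤ t → |Fk k t - F t| ≤ ε k := by
    intro k t ht0
    have hsub : Fk k t - F t = ∫ s in (0 : ℝ)..t, (g k s - η s) := by
      simp only [hFkdef, hFdef]
      rw [intervalIntegral.integral_sub ((hgi k).intervalIntegrable) hη.intervalIntegrable]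
      ring
    rw [hsub, intervalIntegral.integral_of_le ht0]
    calc |∫ s in Ioc 0 t, (g k s - η s)|
        ≤ ∫ s in Ioc 0 t, |g k s - η s| := abs_integral_le_integral_abs
      _ ≤ ∫ s, |g k s - η s| :=
          setIntegral_le_integral ((hgi k).sub hη).abs (ae_of_all _ fun s => abs_nonneg _)
      _ = ∫ s, |η s - g k s| := by
          congr 1; funext s; rw [abs_sub_comm]
      _ ≤ ε k := hgε k
  -- positivity of `1 + Fk` on `[0, T]`
  have hFk_pos : ∀ k, ∀ s ∈ Icc 0 T, 1 / 2 ≤ 1 + Fk k s := by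
    intro k s hs
    have h1 := hclose k s hs.1
    have h2 := hF s hs
    have h3 := hεle k
    have : -(ε k) ≤ Fk k s - F s := (abs_le.1 h1).1
    simp only [hFdef] at this h2 ⊢
    linarith
  have hF_pos : ∀ s ∈ Icc 0 T, 1 ≤ 1 + F s := fun s hs => by
    have := hF s hs; simp only [hFdef]; linarith
  -- FTC for the approximants: `log (1 + Fk t) - log (1 + c) = ∫₀ᵗ g k / (1 + Fk)`
  have htT : Icc 0 t ⊆ Icc 0 T := Icc_subset_Icc_right ht.2
  have hFTCk : ∀ k, log (1 + Fk k t) = log (1 + c) +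
      ∫ s in (0 : ℝ)..t, g k s / (1 + Fk k s) := by
    intro k
    have hderiv : ∀ s ∈ uIcc 0 t, HasDerivAt (fun r => log (1 + Fk k r))
        (g k s / (1 + Fk k s)) s := by
      intro s hs
      rw [uIcc_of_le ht.1] at hs
      have hne : 1 + Fk k s ≠ 0 := by linarith [hFk_pos k s (htT hs)]
      have := ((hFk_deriv k s).const_add 1).log hne
      simpa using this
    have hint : IntervalIntegrable (fun s => g k s / (1 + Fk k s)) volume 0 t := by
      refine ContinuousOn.intervalIntegrable ?_
      rw [uIcc_of_le ht.1]
      refine (hgc k).continuousOn.div (continuousOn_const.add (hFk_cont k).continuousOn) ?_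
      intro s hs
      linarith [hFk_pos k s (htT hs)]
    have := intervalIntegral.integral_eq_sub_of_hasDerivAt hderiv hint
    have hFk0 : Fk k 0 = c := by simp [hFkdef]
    rw [hFk0] at this
    linarith
  -- pass to the limit `k → ∞` on both sides
  have hlim_lhs : Tendsto (fun k => log (1 + Fk k t)) atTop (𝓝 (log (1 + F t))) := by
    have hFkt : Tendsto (fun k => Fk k t) atTop (𝓝 (F t)) := by
      rw [tendsto_iff_norm_sub_tendsto_zero]
      refine squeeze_zero (fun k => norm_nonneg _) (fun k => ?_) hεlim
      rw [Real.norm_eq_abs]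
      exact hclose k t ht.1
    have hne : 1 + F t ≠ 0 := by linarith [hF_pos t ht]
    exact ((continuousAt_log hne).tendsto.comp (tendsto_const_nhds.add hFkt))
  have hmeasF : Measurable F := hFcont.measurable
  have hlimint : IntegrableOn (fun s => η s / (1 + F s)) (Ioc 0 t) := by
    refine Integrable.mono' (hη.abs.restrict (s := Ioc 0 t)) ?_ ?_
    · exact (hη.1.aemeasurable.div
        (measurable_const.add hmeasF).aemeasurable).aestronglyMeasurable.restrict
    · filter_upwards [ae_restrict_mem measurableSet_Ioc] with s hs
      have hs' : s ∈ Icc 0 T := ⟨hs.1.le, hs.2.trans ht.2⟩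
      have h1 : 1 ≤ 1 + F s := hF_pos s hs'
      rw [Real.norm_eq_abs, abs_div, abs_of_pos (show (0 : ℝ) < 1 + F s by linarith)]
      exact div_le_self (abs_nonneg _) h1
  have hlim_rhs : Tendsto (fun k => ∫ s in (0 : ℝ)..t, g k s / (1 + Fk k s)) atTop
      (𝓝 (∫ s in (0 : ℝ)..t, η s / (1 + F s))) := by
    rw [tendsto_iff_norm_sub_tendsto_zero]
    have hbound : ∀ k, ‖(∫ s in (0 : ℝ)..t, g k s / (1 + Fk k s)) -
        ∫ s in (0 : ℝ)..t, η s / (1 + F s)‖ ≤ 2 * ε k + 2 * ε k * ∫ s, |η s| := by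
      intro k
      have hintk : IntegrableOn (fun s => g k s / (1 + Fk k s)) (Ioc 0 t) := by
        refine ContinuousOn.integrableOn_Icc ?_ |>.mono_set Ioc_subset_Icc_self
        refine (hgc k).continuousOn.div (continuousOn_const.add (hFk_cont k).continuousOn) ?_
        intro s hs
        linarith [hFk_pos k s (htT hs)]
      rw [intervalIntegral.integral_of_le ht.1, intervalIntegral.integral_of_le ht.1,
        ← integral_sub hintk hlimint, Real.norm_eq_abs]
      calc |∫ s in Ioc 0 t, (g k s / (1 + Fk k s) - η s / (1 + F s))|
          ≤ ∫ s in Ioc 0 t, |g k s / (1 + Fk k s) - η s / (1 + F s)| :=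
            abs_integral_le_integral_abs
        _ ≤ ∫ s in Ioc 0 t, (2 * |g k s - η s| + 2 * ε k * |η s|) := by
            refine integral_mono_ae (hintk.sub hlimint).abs ?_ ?_
            · exact (((hgi k).sub hη).abs.const_mul 2).add (hη.abs.const_mul _) |>.restrict
            filter_upwards [ae_restrict_mem measurableSet_Ioc] with s hs
            have hs' : s ∈ Icc 0 T := ⟨hs.1.le, hs.2.trans ht.2⟩
            have hA : 1 / 2 ≤ 1 + Fk k s := hFk_pos k s hs'
            have hB : 1 ≤ 1 + F s := hF_pos s hs'
            have hcl : |Fk k s - F s| ≤ ε k := hclose k s hs.1.le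
            have hsplit : g k s / (1 + Fk k s) - η s / (1 + F s) =
                (g k s - η s) / (1 + Fk k s) +
                  η s * ((F s - Fk k s) / ((1 + Fk k s) * (1 + F s))) := by
              field_simp
              ring
            rw [hsplit]
            refine (abs_add_le _ _).trans (add_le_add ?_ ?_)
            · rw [abs_div, abs_of_pos (by linarith : (0 : ℝ) < 1 + Fk k s), div_le_iff₀ (by linarith)]
              nlinarith [abs_nonneg (g k s - η s)]
            · rw [abs_mul, abs_div, abs_mul, abs_of_pos (by linarith : (0 : ℝ) < 1 + Fk k s),
                abs_of_pos (by linarith : (0 : ℝ) < 1 + F s), abs_sub_comm]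
              have hden : 1 / 2 ≤ (1 + Fk k s) * (1 + F s) := by nlinarith
              calc |η s| * (|Fk k s - F s| / ((1 + Fk k s) * (1 + F s)))
                  ≤ |η s| * (ε k / (1 / 2)) := by
                    refine mul_le_mul_of_nonneg_left ?_ (abs_nonneg _)
                    exact div_le_div₀ (hεpos k).le hcl (by norm_num) hden
                _ = 2 * ε k * |η s| := by ring
        _ ≤ ∫ s, (2 * |g k s - η s| + 2 * ε k * |η s|) := by
            refine setIntegral_le_integral
              ((((hgi k).sub hη).abs.const_mul 2).add (hη.abs.const_mul _)) ?_
            exact ae_of_all _ fun s => by positivity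
        _ = 2 * (∫ s, |g k s - η s|) + 2 * ε k * ∫ s, |η s| := by
            have hI1 : Integrable (fun s => 2 * |g k s - η s|) := ((hgi k).sub hη).abs.const_mul 2
            have hI2 : Integrable (fun s => 2 * ε k * |η s|) := hη.abs.const_mul _
            rw [integral_add hI1 hI2, integral_const_mul, integral_const_mul]
        _ ≤ 2 * ε k + 2 * ε k * ∫ s, |η s| := by
            have : ∫ s, |g k s - η s| ≤ ε k := by
              calc ∫ s, |g k s - η s| = ∫ s, |η s - g k s| := by
                    congr 1; funext s; rw [abs_sub_comm]
                _ ≤ ε k := hgε k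
            linarith
    refine squeeze_zero (fun k => norm_nonneg _) hbound ?_
    have : Tendsto (fun k => 2 * ε k + 2 * ε k * ∫ s, |η s|) atTop
        (𝓝 (2 * 0 + 2 * 0 * ∫ s, |η s|)) :=
      (hεlim.const_mul 2).add ((hεlim.const_mul 2).mul_const _)
    simpa using this
  -- conclude by uniqueness of limits
  have hlim_rhs' : Tendsto (fun k => log (1 + c) + ∫ s in (0 : ℝ)..t, g k s / (1 + Fk k s)) atTop
      (𝓝 (log (1 + c) + ∫ s in (0 : ℝ)..t, η s / (1 + F s))) := tendsto_const_nhds.add hlim_rhs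
  have heq : (fun k => log (1 + Fk k t)) =
      fun k => log (1 + c) + ∫ s in (0 : ℝ)..t, g k s / (1 + Fk k s) := funext hFTCk
  rw [heq] at hlim_lhs
  exact tendsto_nhds_unique hlim_lhs hlim_rhs'

end OneD

/-! ## The free-flow shear on phase space and phase space-time -/

section Shear

variable {E : Type*} [NormedAddCommGroup E] [InnerProductSpace ℝ E] [FiniteDimensional ℝ E]
  [MeasurableSpace E] [BorelSpace E]

/-- The free-streaming shear `(x, v) ↦ (x + t v, v)` preserves Lebesgue measure on `E × E`
(CIP 1994 §5.3 Step 4: "`g♯`" is a measure-preserving reparametrisation). [folklore] -/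
theorem measurePreserving_freeShear (t : ℝ) :
    MeasurePreserving (fun z : E × E => (z.1 + t • z.2, z.2)) (volume.prod volume)
      (volume.prod volume) :=
  Literature.Analysis.FluidPDE.measurePreserving_shear (μ := (volume : Measure E)) (ν := (volume : Measure E))
    (fun v x => x + t • v) (by fun_prop) (fun v => map_add_right_eq_self _ _)

/-- The free-flow change of coordinates on phase space-time, `(t, x, v) ↦ (t, x + t v, v)`, so
that `g ∘ shearFlow` is `g♯` (`alongFreeFlow`). [folklore] -/
def shearFlow (q : ℝ × E × E) : ℝ × E × E :=
  (q.1, q.2.1 + q.1 • q.2.2, q.2.2)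

omit [FiniteDimensional ℝ E] [MeasurableSpace E] [BorelSpace E] in
/-- Unfolding of `shearFlow`. [folklore] -/
@[simp]
theorem shearFlow_apply (q : ℝ × E × E) : shearFlow q = (q.1, q.2.1 + q.1 • q.2.2, q.2.2) := rfl

omit [FiniteDimensional ℝ E] [MeasurableSpace E] [BorelSpace E] in
/-- `g ∘ shearFlow = g♯`. [folklore] -/
theorem alongFreeFlow_eq_comp_shearFlow (g : ℝ → E → E → ℝ) (t : ℝ) (z : E × E) :
    alongFreeFlow g t z.1 z.2 = (fun q : ℝ × E × E => g q.1 q.2.1 q.2.2) (shearFlow (t, z)) :=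
  rfl

omit [FiniteDimensional ℝ E] [MeasurableSpace E] [BorelSpace E] in
/-- The free-flow change of coordinates as a homeomorphism of phase space-time. [folklore] -/
def shearFlowHomeomorph : ℝ × E × E ≃ₜ ℝ × E × E where
  toFun := shearFlow
  invFun q := (q.1, q.2.1 - q.1 • q.2.2, q.2.2)
  left_inv q := by simp
  right_inv q := by simp
  continuous_toFun := by unfold shearFlow; fun_prop
  continuous_invFun := by fun_prop

/-- `shearFlow` is a measurable embedding. [folklore] -/
theorem measurableEmbedding_shearFlow : MeasurableEmbedding (shearFlow (E := E)) :=
  (shearFlowHomeomorph (E := E)).measurableEmbedding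

/-- `shearFlow` preserves Lebesgue measure on `ℝ × E × E` (skew product over the time axis of the
measure-preserving shears `measurePreserving_freeShear`). [folklore] -/
theorem measurePreserving_shearFlow :
    MeasurePreserving (shearFlow (E := E)) volume volume := by
  have h := (MeasurePreserving.id (volume : Measure ℝ)).skew_product
    (μc := (volume : Measure (E × E))) (μd := (volume : Measure (E × E)))
    (g := fun (t : ℝ) (z : E × E) => (z.1 + t • z.2, z.2))
    (by fun_prop) (ae_of_all _ fun t => (measurePreserving_freeShear (E := E) t).map_eq)
  exact h

/-- Lebesgue measure on the open half space-time `(0,∞) × E × E` is the product of Lebesgue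
measure on `(0,∞)` and of `volume.prod volume` on `E × E`. [folklore] -/
theorem volume_restrict_Ioi_prod_univ :
    (volume : Measure (ℝ × E × E)).restrict (Ioi 0 ×ˢ univ) =
      ((volume : Measure ℝ).restrict (Ioi 0)).prod ((volume : Measure E).prod volume) := by
  rw [← Measure.restrict_univ (μ := ((volume : Measure E).prod volume)), Measure.prod_restrict]
  rfl

/-- `shearFlow` preserves Lebesgue measure restricted to `(0,∞) × E × E`. [folklore] -/
theorem measurePreserving_shearFlow_restrict :
    MeasurePreserving (shearFlow (E := E)) (volume.restrict (Ioi 0 ×ˢ univ))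
      (volume.restrict (Ioi 0 ×ˢ univ)) := by
  have h := (measurePreserving_shearFlow (E := E)).restrict_preimage
    (s := Ioi (0 : ℝ) ×ˢ (univ : Set (E × E)))
    ((measurableSet_Ioi (a := (0 : ℝ))).prod (MeasurableSet.univ (α := E × E)))
  have hpre : shearFlow ⁻¹' (Ioi (0 : ℝ) ×ˢ (univ : Set (E × E))) = Ioi 0 ×ˢ univ := by
    ext q; simp
  rwa [hpre] at h

end Shear

/-! ## Measurability of the collision functionals and their values at points of absolute convergence -/

section Collision

variable {E : Type*} [NormedAddCommGroup E] [InnerProductSpace ℝ E] [FiniteDimensional ℝ E]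
  [MeasurableSpace E] [BorelSpace E] {B : E × E → sphere (0 : E) 1 → ℝ}

/-- The gain term with measurably varying density and velocity is measurable in the parameter
(Fubini measurability of parametric integrals, twice). [folklore] -/
theorem measurable_gainWith_param {α : Type*} [MeasurableSpace α]
    (hBm : Measurable (Function.uncurry B)) {g : α → E → ℝ} (hg : Measurable (Function.uncurry g))
    {u : α → E} (hu : Measurable u) :
    Measurable fun a => Literature.Analysis.FluidPDE.gainWith B (g a) (g a) (u a) := by
  haveI := Literature.Analysis.FluidPDE.isFiniteMeasure_sphereMeasure (E := E)
  have hr : Measurable fun q : (α × E) × sphere (0 : E) 1 => ((u q.1.1, q.1.2), q.2) :=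
    ((hu.comp measurable_fst.fst).prodMk measurable_fst.snd).prodMk measurable_snd
  have ha : Measurable fun q : (α × E) × sphere (0 : E) 1 => q.1.1 := measurable_fst.fst
  have hc1 : Measurable fun q : (α × E) × sphere (0 : E) 1 =>
      (KineticTheory.collide q.2 (u q.1.1, q.1.2)).1 :=
    Literature.Analysis.FluidPDE.continuous_collide_uncurry.fst.measurable.comp hr
  have hc2 : Measurable fun q : (α × E) × sphere (0 : E) 1 =>
      (KineticTheory.collide q.2 (u q.1.1, q.1.2)).2 :=
    Literature.Analysis.FluidPDE.continuous_collide_uncurry.snd.measurable.comp hr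
  have hk : Measurable fun q : (α × E) × sphere (0 : E) 1 =>
      B (u q.1.1, q.1.2) q.2 * (g q.1.1 (KineticTheory.collide q.2 (u q.1.1, q.1.2)).1 *
        g q.1.1 (KineticTheory.collide q.2 (u q.1.1, q.1.2)).2) :=
    (hBm.comp hr).mul ((hg.comp (ha.prodMk hc1)).mul (hg.comp (ha.prodMk hc2)))
  have h1 := hk.stronglyMeasurable.integral_prod_right'
    (ν := (KineticTheory.sphereMeasure : Measure (sphere (0 : E) 1)))
  have h2 := h1.integral_prod_right' (ν := (volume : Measure E))
  exact h2.measurable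

/-- The loss term with measurably varying density and velocity is measurable in the parameter.
[folklore] -/
theorem measurable_lossWith_param {α : Type*} [MeasurableSpace α]
    (hBm : Measurable (Function.uncurry B)) {g : α → E → ℝ} (hg : Measurable (Function.uncurry g))
    {u : α → E} (hu : Measurable u) :
    Measurable fun a => Literature.Analysis.FluidPDE.lossWith B (g a) (g a) (u a) := by
  haveI := Literature.Analysis.FluidPDE.isFiniteMeasure_sphereMeasure (E := E)
  have hr : Measurable fun q : (α × E) × sphere (0 : E) 1 => ((u q.1.1, q.1.2), q.2) :=
    ((hu.comp measurable_fst.fst).prodMk measurable_fst.snd).prodMk measurable_snd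
  have ha : Measurable fun q : (α × E) × sphere (0 : E) 1 => q.1.1 := measurable_fst.fst
  have hk : Measurable fun q : (α × E) × sphere (0 : E) 1 =>
      B (u q.1.1, q.1.2) q.2 * (g q.1.1 (u q.1.1) * g q.1.1 q.1.2) :=
    (hBm.comp hr).mul ((hg.comp (ha.prodMk (hu.comp ha))).mul (hg.comp (ha.prodMk measurable_fst.snd)))
  have h1 := hk.stronglyMeasurable.integral_prod_right'
    (ν := (KineticTheory.sphereMeasure : Measure (sphere (0 : E) 1)))
  have h2 := h1.integral_prod_right' (ν := (volume : Measure E))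
  exact h2.measurable

/-- **Discharge of `Kinetic.collisionOpWith_eq_gainWith_sub_lossWith`** (CIP 1994 (3.1.11)): if
the gain and loss integrands are integrable over `E × S^{d-1}` at `v`, then
`Q_B(f, g)(v) = Q_B⁺(f, g)(v) - Q_B⁻(f, g)(v)`; the Bochner integrals `gainWith`, `lossWith` are
then the product integrals (Fubini) and `collisionOpWith` is the integral of the difference. [cite: CIPDiluteGases1994, §3.1 (3.1.11)] -/
theorem collisionOpWith_eq_gainWith_sub_lossWith_holds :
    Literature.Analysis.FluidPDE.collisionOpWith_eq_gainWith_sub_lossWith (E := E) := by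
  intro B f g v hG hL
  haveI := Literature.Analysis.FluidPDE.isFiniteMeasure_sphereMeasure (E := E)
  have hgain : Literature.Analysis.FluidPDE.gainWith B f g v = ∫ q, B (v, q.1) q.2 *
      (f (KineticTheory.collide q.2 (v, q.1)).1 * g (KineticTheory.collide q.2 (v, q.1)).2)
      ∂(volume.prod KineticTheory.sphereMeasure) := by
    rw [Literature.Analysis.FluidPDE.gainWith, integral_prod _ hG]
  have hloss : Literature.Analysis.FluidPDE.lossWith B f g v = ∫ q, B (v, q.1) q.2 * (f v * g q.1)
      ∂(volume.prod KineticTheory.sphereMeasure) := by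
    rw [Literature.Analysis.FluidPDE.lossWith, integral_prod _ hL]
  have hGL : Integrable (fun q : E × sphere (0 : E) 1 => B (v, q.1) q.2 *
      (f (KineticTheory.collide q.2 (v, q.1)).1 * g (KineticTheory.collide q.2 (v, q.1)).2) -
      B (v, q.1) q.2 * (f v * g q.1)) (volume.prod KineticTheory.sphereMeasure) := hG.sub hL
  have hQ : Literature.Analysis.FluidPDE.collisionOpWith B f g v = ∫ q, (B (v, q.1) q.2 *
      (f (KineticTheory.collide q.2 (v, q.1)).1 * g (KineticTheory.collide q.2 (v, q.1)).2) -
      B (v, q.1) q.2 * (f v * g q.1)) ∂(volume.prod KineticTheory.sphereMeasure) := by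
    rw [Literature.Analysis.FluidPDE.collisionOpWith, integral_prod _ hGL]
    refine integral_congr_ae (ae_of_all _ fun w => integral_congr_ae (ae_of_all _ fun ω => ?_))
    simp only [mul_sub]
  rw [hQ, integral_sub hG hL, hgain, hloss]

end Collision

/-! ## Calculus of kinetic test functions -/

section TestFunctions

variable {E : Type*} [NormedAddCommGroup E] [InnerProductSpace ℝ E]

omit [InnerProductSpace ℝ E] in
/-- For a `C¹` function on phase space-time, `∂ₜφ + v·∇ₓφ` at `(t, x, v)` is the Fréchet derivative
in the direction `(1, v, 0)`. [folklore] -/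
theorem deriv_add_fderiv_eq_fderiv [NormedSpace ℝ E] {φ : ℝ → E → E → ℝ}
    (hφ : Differentiable ℝ (fun z : ℝ × E × E => φ z.1 z.2.1 z.2.2)) (t : ℝ) (x v : E) :
    deriv (fun s => φ s x v) t + fderiv ℝ (fun y => φ t y v) x v =
      fderiv ℝ (fun z : ℝ × E × E => φ z.1 z.2.1 z.2.2) (t, x, v) ((1 : ℝ), v, (0 : E)) := by
  set Φ : ℝ × E × E → ℝ := fun z => φ z.1 z.2.1 z.2.2 with hΦ
  have hΦ' : HasFDerivAt Φ (fderiv ℝ Φ (t, x, v)) (t, x, v) := (hφ (t, x, v)).hasFDerivAt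
  -- time derivative
  have hγ : HasDerivAt (fun s : ℝ => ((s, x, v) : ℝ × E × E)) ((1 : ℝ), (0 : E), (0 : E)) t :=
    (hasDerivAt_id t).prodMk ((hasDerivAt_const t x).prodMk (hasDerivAt_const t v))
  have h1 : deriv (fun s => φ s x v) t = fderiv ℝ Φ (t, x, v) ((1 : ℝ), (0 : E), (0 : E)) := by
    have := hΦ'.comp_hasDerivAt t hγ
    exact this.deriv
  -- space derivative
  set L : E →L[ℝ] ℝ × E × E := (0 : E →L[ℝ] ℝ).prod ((ContinuousLinearMap.id ℝ E).prod 0)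
    with hL
  have hι : HasFDerivAt (fun y : E => ((t, y, v) : ℝ × E × E)) L x :=
    (hasFDerivAt_const t x).prodMk ((hasFDerivAt_id x).prodMk (hasFDerivAt_const v x))
  have h2 : fderiv ℝ (fun y => φ t y v) x v = fderiv ℝ Φ (t, x, v) ((0 : ℝ), v, (0 : E)) := by
    have := (hΦ'.comp x hι).fderiv
    rw [show (fun y => φ t y v) = Φ ∘ fun y : E => ((t, y, v) : ℝ × E × E) from rfl, this]
    simp [hL]
  rw [h1, h2, ← map_add]
  simp

omit [InnerProductSpace ℝ E] in
/-- Derivative of a `C¹` function along a free-flow characteristic: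
`d/dt Φ(t, x + t v, v) = (∂ₜ + v·∇ₓ) Φ (t, x + t v, v)`. [folklore] -/
theorem hasDerivAt_comp_characteristic [NormedSpace ℝ E] {Φ : ℝ × E × E → ℝ}
    (hΦ : Differentiable ℝ Φ) (x v : E) (t : ℝ) :
    HasDerivAt (fun s : ℝ => Φ (s, x + s • v, v))
      (fderiv ℝ Φ (t, x + t • v, v) ((1 : ℝ), v, (0 : E))) t := by
  have hγ : HasDerivAt (fun s : ℝ => ((s, x + s • v, v) : ℝ × E × E)) ((1 : ℝ), v, (0 : E)) t := by
    have h2 : HasDerivAt (fun s : ℝ => x + s • v) v t := by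
      simpa using ((hasDerivAt_id t).smul_const v).const_add x
    exact (hasDerivAt_id t).prodMk (h2.prodMk (hasDerivAt_const t v))
  exact (hΦ (t, x + t • v, v)).hasFDerivAt.comp_hasDerivAt t hγ

/-- Bounds on the support of a kinetic test function: there are `0 < a ≤ b` and `R ≥ 0` with
`tsupport φ ⊆ [a, b] × {|(x, v)| ≤ R}`. [folklore] -/
theorem _root_.Literature.Analysis.FluidPDE.IsKineticTest.exists_support_bounds [FiniteDimensional ℝ E] [MeasurableSpace E]
    [BorelSpace E] {φ : ℝ → E → E → ℝ} (hφ : Literature.Analysis.FluidPDE.IsKineticTest φ) :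
    ∃ a b R : ℝ, 0 < a ∧ a ≤ b ∧ 0 ≤ R ∧
      ∀ z ∈ tsupport (fun z : ℝ × E × E => φ z.1 z.2.1 z.2.2), a ≤ z.1 ∧ z.1 ≤ b ∧ ‖z.2‖ ≤ R := by
  set K := tsupport (fun z : ℝ × E × E => φ z.1 z.2.1 z.2.2) with hK
  have hKc : IsCompact K := hφ.2.1
  obtain ⟨R₀, hR₀⟩ := hKc.isBounded.exists_norm_le
  rcases K.eq_empty_or_nonempty with hKe | hKne
  · exact ⟨1, 1, 0, one_pos, le_rfl, le_rfl, fun z hz => by simp [hKe] at hz⟩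
  obtain ⟨p₀, hp₀, hmin⟩ := hKc.exists_isMinOn hKne continuous_fst.continuousOn
  have ha : 0 < p₀.1 := by
    have := hφ.2.2 hp₀
    exact (mem_prod.1 this).1
  refine ⟨p₀.1, max R₀ p₀.1, max R₀ 0, ha, le_max_right _ _, le_max_right _ _, fun z hz => ?_⟩
  have hn := hR₀ z hz
  refine ⟨hmin hz, ?_, ?_⟩
  · exact le_trans ((le_abs_self _).trans ((Real.norm_eq_abs _ ▸ norm_fst_le z).trans hn))
      (le_max_left _ _)
  · exact ((norm_snd_le z).trans hn).trans (le_max_left _ _)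

end TestFunctions

end Literature.MathematicalPhysics.KineticTheory

namespace Literature.MathematicalPhysics.KineticTheory

open MeasureTheory Metric Real Set Filter Topology
open scoped InnerProductSpace ENNReal

section AEHelpers

/-- Swapping the order of "almost everywhere" over a product measure (no measurability of the
property is needed: `Prod.swap` is a measurable equivalence). [folklore] -/
theorem ae_ae_swap_of_ae_prod {α β : Type*} [MeasurableSpace α] [MeasurableSpace β]
    {μ : Measure α} {ν : Measure β} [SFinite μ] [SFinite ν] {p : α × β → Prop}
    (h : ∀ᵐ q ∂(μ.prod ν), p q) : ∀ᵐ y ∂ν, ∀ᵐ x ∂μ, p (x, y) := by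
  have h' : ∀ᵐ q ∂(ν.prod μ), p q.swap := by
    rw [ae_iff] at h ⊢
    rw [← Measure.prod_swap,
      show (Prod.swap : α × β → β × α) = (MeasurableEquiv.prodComm : α × β ≃ᵐ β × α) from rfl,
      MeasurableEquiv.map_apply]
    change (μ.prod ν) {a | ¬p a.swap.swap} = 0
    simpa using h
  exact Measure.ae_ae_of_ae_prod h'

end AEHelpers

section Main

variable {E : Type*} [NormedAddCommGroup E] [InnerProductSpace ℝ E] [FiniteDimensional ℝ E]
  [MeasurableSpace E] [BorelSpace E]

/-- An iterated integral `∫_{t>0} ∫_x ∫_v` of a function integrable on `(0,∞) × E × E` is the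
integral over the half space-time. [folklore] -/
theorem integral_Ioi_integral_integral_eq {H : ℝ × E × E → ℝ}
    (hH : Integrable H (volume.restrict (Ioi 0 ×ˢ univ))) :
    ∫ t in Ioi (0 : ℝ), ∫ x : E, ∫ v : E, H (t, x, v) =
      ∫ z, H z ∂(volume.restrict (Ioi 0 ×ˢ univ)) := by
  rw [volume_restrict_Ioi_prod_univ] at hH ⊢
  rw [integral_prod _ hH]
  refine integral_congr_ae ?_
  filter_upwards [hH.prod_right_ae] with t ht
  exact (integral_prod _ ht).symm

/-- Integrals over `(0,∞) × E × E` in free-flow coordinates: `∫ G = ∫_{(x,v)} ∫_{t>0} G♯`, for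
`G` integrable. [folklore] -/
theorem integral_eq_integral_integral_shearFlow {G : ℝ × E × E → ℝ}
    (hG : Integrable G (volume.restrict (Ioi 0 ×ˢ univ))) :
    ∫ z, G z ∂(volume.restrict (Ioi 0 ×ˢ univ)) =
      ∫ zz : E × E, (∫ t in Ioi (0 : ℝ), G (shearFlow (t, zz))) ∂(volume.prod volume) := by
  have hmp := measurePreserving_shearFlow_restrict (E := E)
  have hint : Integrable (G ∘ shearFlow) (volume.restrict (Ioi 0 ×ˢ univ)) :=
    (hmp.integrable_comp_emb measurableEmbedding_shearFlow).2 hG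
  rw [← hmp.integral_comp measurableEmbedding_shearFlow G]
  rw [volume_restrict_Ioi_prod_univ] at hint ⊢
  exact integral_prod_symm _ hint

/-- Integrability along almost every characteristic, in free-flow coordinates. [folklore] -/
theorem ae_integrableOn_shearFlow {G : ℝ × E × E → ℝ}
    (hG : Integrable G (volume.restrict (Ioi 0 ×ˢ univ))) :
    ∀ᵐ zz : E × E ∂(volume.prod volume),
      Integrable (fun t => G (shearFlow (t, zz))) (volume.restrict (Ioi 0)) := by
  have hmp := measurePreserving_shearFlow_restrict (E := E)
  have hint : Integrable (G ∘ shearFlow) (volume.restrict (Ioi 0 ×ˢ univ)) :=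
    (hmp.integrable_comp_emb measurableEmbedding_shearFlow).2 hG
  rw [volume_restrict_Ioi_prod_univ] at hint
  exact hint.prod_left_ae

/-- Almost-everywhere statements on `(0,∞) × E × E` read in free-flow coordinates: for a.e.
`(x, v)`, for a.e. `t > 0`. [folklore] -/
theorem ae_ae_shearFlow_of_ae {p : ℝ × E × E → Prop}
    (h : ∀ᵐ z ∂(volume.restrict (Ioi (0 : ℝ) ×ˢ (univ : Set (E × E)))), p z) :
    ∀ᵐ zz : E × E ∂(volume.prod volume), ∀ᵐ t ∂(volume.restrict (Ioi (0 : ℝ))),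
      p (shearFlow (t, zz)) := by
  have h' := (measurePreserving_shearFlow_restrict (E := E)).quasiMeasurePreserving.ae h
  rw [volume_restrict_Ioi_prod_univ] at h'
  exact ae_ae_swap_of_ae_prod h'

/-- **Discharge of (D5)** (`renormalisedIdentity_of_isAEMildSolution`; CIP 1994 §5.3 Lemma
5.3.4 (ii), Appendix 5.A pp. 164–166). Proof: write the pairing as an integral over
`(0,∞) × E × E`, pass to free-flow coordinates `(t, x + t v, v)` (a measure-preserving shear),
and exchange the order of integration; along almost every characteristic, Duhamel's formula
exhibits `f♯` as a primitive `f₀ + ∫₀ᵗ Q(f,f)♯`, which is nonnegative, so that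
`log (1 + f♯) = log (1 + f₀) + ∫₀ᵗ Q(f,f)♯/(1 + f♯)` (`log_one_add_primitive_eq`), and an
integration by parts in time against the test function (`integral_Ioi_primitive_mul_deriv`) gives
`∫ log(1+f♯) (Tφ)♯ dt = -∫ (Q(f,f)/(1+f))♯ φ♯ dt`; undoing the shear yields the identity. [cite: CIPDiluteGases1994, §5.3 Lemma 5.3.4 (ii) and Appendix 5.A (pp. 164–166)] -/
theorem renormalisedIdentity_of_isAEMildSolution_holds :
    renormalisedIdentity_of_isAEMildSolution := by
  intro E _ _ _ _ _ B hB f hf0 hfm hfloc hgain hloss hmild φ hφ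
  haveI := Literature.Analysis.FluidPDE.isFiniteMeasure_sphereMeasure (E := E)
  -- ### notation
  set Φ : ℝ × E × E → ℝ := fun z => φ z.1 z.2.1 z.2.2 with hΦdef
  set F3 : ℝ × E × E → ℝ := fun z => f z.1 z.2.1 z.2.2 with hF3def
  set Qc : ℝ × E × E → ℝ := fun z => Literature.Analysis.FluidPDE.collisionOpWith B (f z.1 z.2.1) (f z.1 z.2.1) z.2.2
    with hQcdef
  set Gc : ℝ × E × E → ℝ := fun z => Literature.Analysis.FluidPDE.gainWith B (f z.1 z.2.1) (f z.1 z.2.1) z.2.2 with hGcdef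
  set Lc : ℝ × E × E → ℝ := fun z => Literature.Analysis.FluidPDE.lossWith B (f z.1 z.2.1) (f z.1 z.2.1) z.2.2 with hLcdef
  set S : Set (ℝ × E × E) := Ioi 0 ×ˢ univ with hSdef
  have hSm : MeasurableSet S := measurableSet_Ioi.prod MeasurableSet.univ
  -- ### the test function
  have hone : ((⊤ : ℕ∞) : WithTop ℕ∞) ≠ 0 := by simp
  have hΦs : ContDiff ℝ ((⊤ : ℕ∞) : WithTop ℕ∞) Φ := hφ.1
  have hΦd : Differentiable ℝ Φ := hΦs.differentiable hone
  have hΦc : Continuous Φ := hΦd.continuous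
  set DΦ : ℝ × E × E → ℝ := fun z => fderiv ℝ Φ z ((1 : ℝ), z.2.2, (0 : E)) with hDΦdef
  have hDΦc : Continuous DΦ :=
    (hΦs.continuous_fderiv hone).clm_apply (continuous_const.prodMk
      (continuous_snd.snd.prodMk continuous_const))
  set K : Set (ℝ × E × E) := tsupport Φ with hKdef
  have hKc : IsCompact K := hφ.2.1
  have hΦK : ∀ z, z ∉ K → Φ z = 0 := fun z hz => image_eq_zero_of_notMem_tsupport hz
  have hDΦK : ∀ z, z ∉ K → DΦ z = 0 := fun z hz => by
    show fderiv ℝ Φ z ((1 : ℝ), z.2.2, (0 : E)) = 0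
    rw [fderiv_of_notMem_tsupport ℝ hz]
    rfl
  obtain ⟨a, b, R, ha, hab, hR, hKbd⟩ := hφ.exists_support_bounds
  have hnotK : ∀ z : ℝ × E × E, (z.1 < a ∨ b < z.1) → z ∉ K := by
    intro z hz hzK
    obtain ⟨h1, h2, _⟩ := hKbd z hzK
    rcases hz with h | h <;> linarith
  obtain ⟨M, hM⟩ : ∃ M : ℝ, ∀ z, |Φ z| ≤ M ∧ |DΦ z| ≤ M := by
    obtain ⟨M₁, hM₁⟩ := hΦc.bounded_above_of_compact_support hφ.2.1
    obtain ⟨M₂, hM₂⟩ := hDΦc.bounded_above_of_compact_support (HasCompactSupport.intro hKc hDΦK)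
    exact ⟨max M₁ M₂, fun z => ⟨(Real.norm_eq_abs _ ▸ hM₁ z).trans (le_max_left _ _),
      (Real.norm_eq_abs _ ▸ hM₂ z).trans (le_max_right _ _)⟩⟩
  -- the box containing the support
  set b' : ℝ := b + 1 with hb'def
  have hb' : 0 < b' := by linarith
  set Kb : Set (ℝ × E × E) := Icc 0 b' ×ˢ closedBall (0 : E × E) R with hKbdef
  have hKbc : IsCompact Kb := isCompact_Icc.prod (isCompact_closedBall _ _)
  have hKbm : MeasurableSet Kb := hKbc.measurableSet
  have hKbS : Kb ⊆ Ici 0 ×ˢ univ := prod_mono Icc_subset_Ici_self (subset_univ _)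
  have hKKb : K ⊆ Kb := fun z hz => by
    obtain ⟨h1, h2, h3⟩ := hKbd z hz
    exact ⟨⟨ha.le.trans h1, by linarith⟩, mem_closedBall_zero_iff.2 h3⟩
  have hzeroKb : ∀ z, z ∉ Kb → Φ z = 0 ∧ DΦ z = 0 := fun z hz =>
    ⟨hΦK z fun h => hz (hKKb h), hDΦK z fun h => hz (hKKb h)⟩
  -- ### measurability
  have hBm : Measurable (Function.uncurry B) := hB.measurable
  have hgm : Measurable (Function.uncurry fun (a : ℝ × E × E) (w : E) => f a.1 a.2.1 w) :=
    hfm.comp ((measurable_fst.comp measurable_fst).prodMk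
      ((measurable_fst.comp (measurable_snd.comp measurable_fst)).prodMk measurable_snd))
  have hQcm : Measurable Qc :=
    Literature.Analysis.FluidPDE.measurable_collisionOpWith_param (α := ℝ × E × E) hBm hgm measurable_snd.snd
  have hGcm : Measurable Gc :=
    measurable_gainWith_param (α := ℝ × E × E) hBm hgm measurable_snd.snd
  have hLcm : Measurable Lc :=
    measurable_lossWith_param (α := ℝ × E × E) hBm hgm measurable_snd.snd
  have hDΦm : Measurable DΦ := hDΦc.measurable
  have hΦm : Measurable Φ := hΦc.measurable
  -- ### `Q = Q⁺ - Q⁻` almost everywhere on `S`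
  have hQG : ∀ᵐ z ∂(volume.restrict S), Qc z = Gc z - Lc z := by
    filter_upwards [hmild.gain_integrable_ae, hmild.loss_integrable_ae] with z hGz hLz
    exact collisionOpWith_eq_gainWith_sub_lossWith_holds B _ _ _ hGz hLz
  -- ### integrability of the two pairings on `S`
  have hF3Kb : IntegrableOn F3 Kb volume := hfloc.integrableOn_compact_subset hKbS hKbc
  have hGKb : IntegrableOn (fun z => Gc z / (1 + F3 z)) Kb volume :=
    hgain.integrableOn_compact_subset hKbS hKbc
  have hLKb : IntegrableOn (fun z => Lc z / (1 + F3 z)) Kb volume :=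
    hloss.integrableOn_compact_subset hKbS hKbc
  have hnonnegKb : ∀ z ∈ Kb, 0 ≤ F3 z := fun z hz => hf0 z.1 hz.1.1 z.2.1 z.2.2
  set H₁ : ℝ × E × E → ℝ := fun z => log (1 + F3 z) * DΦ z with hH₁def
  set H₂ : ℝ × E × E → ℝ := fun z => Qc z / (1 + F3 z) * Φ z with hH₂def
  have hH₁S : Integrable H₁ (volume.restrict S) := by
    have hlog : IntegrableOn (fun z => log (1 + F3 z)) Kb volume := by
      refine Integrable.mono' hF3Kb ?_ ?_
      · exact ((measurable_const.add hfm).log).aestronglyMeasurable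
      · filter_upwards [ae_restrict_mem hKbm] with z hz
        have h0 := hnonnegKb z hz
        rw [Real.norm_eq_abs, abs_of_nonneg (log_nonneg (by linarith))]
        exact (log_le_sub_one_of_pos (by linarith)).trans (by linarith)
    have hKb1 : IntegrableOn H₁ Kb volume :=
      hlog.mul_bdd hDΦm.aestronglyMeasurable (ae_of_all _ fun z => by
        rw [Real.norm_eq_abs]; exact (hM z).2)
    exact hKb1.of_forall_sdiff_eq_zero hSm fun z hz => by
      simp only [hH₁def, (hzeroKb z hz.2).2, mul_zero]
  have hH₂S : Integrable H₂ (volume.restrict S) := by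
    have hKb2 : IntegrableOn (fun z => (Gc z / (1 + F3 z) - Lc z / (1 + F3 z)) * Φ z) Kb volume :=
      (hGKb.sub hLKb).mul_bdd hΦm.aestronglyMeasurable (ae_of_all _ fun z => by
        rw [Real.norm_eq_abs]; exact (hM z).1)
    have hS2 : IntegrableOn (fun z => (Gc z / (1 + F3 z) - Lc z / (1 + F3 z)) * Φ z) S volume :=
      hKb2.of_forall_sdiff_eq_zero hSm fun z hz => by
        simp only [(hzeroKb z hz.2).1, mul_zero]
    refine hS2.congr_fun_ae ?_
    filter_upwards [hQG] with z hz
    simp only [hH₂def, hz, sub_div]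
  -- ### Step 1: the pairing as an integral over `S`
  have hstep1 : ∫ t in Ioi (0 : ℝ), ∫ x, ∫ v, (log (1 + f t x v) *
      (deriv (fun s => φ s x v) t + fderiv ℝ (fun y => φ t y v) x v) +
      Literature.Analysis.FluidPDE.renormalisedRHS B f t x v * φ t x v) = ∫ z, (H₁ z + H₂ z) ∂(volume.restrict S) := by
    have hsum : Integrable (fun z => H₁ z + H₂ z) (volume.restrict S) := hH₁S.add hH₂S
    rw [← integral_Ioi_integral_integral_eq hsum]
    refine integral_congr_ae (ae_of_all _ fun t => integral_congr_ae (ae_of_all _ fun x =>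
      integral_congr_ae (ae_of_all _ fun v => ?_)))
    simp only [hH₁def, hH₂def, hDΦdef, hF3def, hQcdef, hΦdef, Literature.Analysis.FluidPDE.renormalisedRHS,
      deriv_add_fderiv_eq_fderiv hΦd t x v]
  -- ### Step 2: free-flow coordinates
  have hI₁ := integral_eq_integral_integral_shearFlow hH₁S
  have hI₂ := integral_eq_integral_integral_shearFlow hH₂S
  -- ### Step 3: the identity along almost every characteristic
  -- Duhamel's formula, jointly a.e.
  set P : ℝ → E × E → ℝ := fun t zz => ∫ s in Ioc 0 t, Qc (shearFlow (s, zz)) with hPdef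
  have hPm : Measurable (fun q : ℝ × E × E => P q.1 q.2) := by
    have hind : Measurable (fun y : (ℝ × E × E) × ℝ =>
        ({y : (ℝ × E × E) × ℝ | 0 < y.2 ∧ y.2 ≤ y.1.1} : Set _).indicator
          (fun y => Qc (shearFlow (y.2, y.1.2))) y) := by
      refine Measurable.indicator ?_ ?_
      · exact hQcm.comp (measurableEmbedding_shearFlow.measurable.comp
          (measurable_snd.prodMk (measurable_snd.comp measurable_fst)))
      · exact (measurableSet_lt measurable_const measurable_snd).inter
          (measurableSet_le measurable_snd (measurable_fst.comp measurable_fst))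
    have hsm := hind.stronglyMeasurable.integral_prod_right' (ν := (volume : Measure ℝ))
    have hPeq : (fun q : ℝ × E × E => P q.1 q.2) = fun x => ∫ y,
        ({y : (ℝ × E × E) × ℝ | 0 < y.2 ∧ y.2 ≤ y.1.1} : Set _).indicator
          (fun y => Qc (shearFlow (y.2, y.1.2))) (x, y) := by
      funext q
      simp only [hPdef]
      rw [← integral_indicator measurableSet_Ioc]
      congr 1
    rw [hPeq]
    exact hsm.measurable
  have hDuh : ∀ᵐ zz : E × E ∂(volume.prod volume), ∀ᵐ t ∂(volume.restrict (Ioi (0 : ℝ))),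
      F3 (shearFlow (t, zz)) = f 0 zz.1 zz.2 + P t zz := by
    have hset : MeasurableSet {q : ℝ × (E × E) | F3 (shearFlow (q.1, q.2)) =
        f 0 q.2.1 q.2.2 + P q.1 q.2} := by
      refine measurableSet_eq_fun (hfm.comp measurableEmbedding_shearFlow.measurable) ?_
      exact ((hfm.comp (measurable_const.prodMk measurable_snd)).add hPm)
    refine (Measure.ae_ae_comm (μ := volume.restrict (Ioi (0 : ℝ)))
      (ν := (volume : Measure E).prod volume) hset).1 ?_
    filter_upwards [ae_restrict_mem measurableSet_Ioi] with t ht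
    filter_upwards [hmild.duhamel t (le_of_lt ht)] with zz hzz
    rw [alongFreeFlow_apply, intervalIntegral.integral_of_le (le_of_lt ht)] at hzz
    simpa [hF3def, hPdef, alongFreeFlow, Literature.Analysis.FluidPDE.collisionTerm] using hzz
  -- `Q = Q⁺ - Q⁻` along a.e. characteristic
  have hQG' := ae_ae_shearFlow_of_ae hQG
  -- integrability of `H₂♯` along a.e. characteristic (for the final integral)
  -- the conclusion along a.e. characteristic
  have hchar : ∀ᵐ zz : E × E ∂(volume.prod volume),
      ∫ t in Ioi (0 : ℝ), H₁ (shearFlow (t, zz)) = -∫ t in Ioi (0 : ℝ), H₂ (shearFlow (t, zz)) := by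
    filter_upwards [hmild.gain_integrableOn, hmild.loss_integrableOn, hDuh, hQG']
      with zz hGi hLi hDu hQz
    -- data along this characteristic
    set c : ℝ := f 0 zz.1 zz.2 with hcdef
    have hc : 0 ≤ c := hf0 0 le_rfl _ _
    set q : ℝ → ℝ := fun s => Qc (shearFlow (s, zz)) with hqdef
    have hqint : IntegrableOn q (Ioc 0 b') volume := by
      have h1 : IntegrableOn (fun s => Gc (shearFlow (s, zz)) - Lc (shearFlow (s, zz))) (Ioc 0 b')
          volume := ((hGi b').sub (hLi b')).mono_set Ioc_subset_Icc_self
      refine h1.congr_fun_ae ?_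
      have := ae_restrict_of_ae_restrict_of_subset (Ioc_subset_Ioi_self : Ioc (0 : ℝ) b' ⊆ Ioi 0)
        hQz
      filter_upwards [this] with s hs
      exact hs.symm
    set η : ℝ → ℝ := (Ioc 0 b').indicator q with hηdef
    have hηint : Integrable η := hqint.integrable_indicator measurableSet_Ioc
    -- the primitive and its identification with `P`
    have hprim : ∀ t ∈ Icc 0 b', ∫ s in (0 : ℝ)..t, η s = P t zz := by
      intro t ht
      rw [intervalIntegral.integral_of_le ht.1, hPdef]
      refine setIntegral_congr_fun measurableSet_Ioc fun s hs => ?_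
      simp only [hηdef, indicator_of_mem (show s ∈ Ioc 0 b' from ⟨hs.1, hs.2.trans ht.2⟩), hqdef]
    -- continuity of the primitive
    have hFcont : Continuous fun t => c + ∫ s in (0 : ℝ)..t, η s :=
      continuous_const.add (intervalIntegral.continuous_primitive
        (fun a b => hηint.intervalIntegrable) 0)
    -- nonnegativity of the primitive on `[0, b']`
    have hFnonneg : ∀ t ∈ Icc 0 b', 0 ≤ c + ∫ s in (0 : ℝ)..t, η s := by
      refine nonneg_of_ae_nonneg_of_continuousOn hb' hFcont.continuousOn ?_
      have hDu' := ae_restrict_of_ae_restrict_of_subset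
        (Ioo_subset_Ioi_self : Ioo (0 : ℝ) b' ⊆ Ioi 0) hDu
      filter_upwards [hDu', ae_restrict_mem measurableSet_Ioo] with t ht htI
      rw [hprim t (Ioo_subset_Icc_self htI), ← ht]
      exact hf0 t htI.1.le _ _
    -- the chain rule in integral form
    have hlog : ∀ t ∈ Icc 0 b', log (1 + (c + ∫ s in (0 : ℝ)..t, η s)) =
        log (1 + c) + ∫ s in (0 : ℝ)..t, η s / (1 + (c + ∫ r in (0 : ℝ)..s, η r)) :=
      fun t ht => log_one_add_primitive_eq hηint hFnonneg ht
    -- the test function along the characteristic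
    set ρ : ℝ → ℝ := fun t => Φ (shearFlow (t, zz)) with hρdef
    set ρ' : ℝ → ℝ := fun t => DΦ (shearFlow (t, zz)) with hρ'def
    have hρ : ∀ t, HasDerivAt ρ (ρ' t) t := fun t => by
      have := hasDerivAt_comp_characteristic hΦd zz.1 zz.2 t
      simpa [hρdef, hρ'def, hDΦdef] using this
    have hρ'c : Continuous ρ' :=
      hDΦc.comp ((shearFlowHomeomorph (E := E)).continuous.comp
        (continuous_id.prodMk continuous_const))
    have hρb : ∀ t, b' ≤ t → ρ t = 0 := fun t ht =>
      hΦK _ (hnotK _ (Or.inr (by simp only [shearFlow_apply]; linarith)))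
    have hρ'b : ∀ t, b' ≤ t → ρ' t = 0 := fun t ht =>
      hDΦK _ (hnotK _ (Or.inr (by simp only [shearFlow_apply]; linarith)))
    have hρ0 : ρ 0 = 0 := hΦK _ (hnotK _ (Or.inl (by simp only [shearFlow_apply]; linarith)))
    -- the renormalised integrand along the characteristic
    set η' : ℝ → ℝ := fun s => η s / (1 + (c + ∫ r in (0 : ℝ)..s, η r)) with hη'def
    have hη'int : IntegrableOn η' (Ioc 0 b') volume := by
      refine Integrable.mono' (hηint.abs.restrict (s := Ioc 0 b')) ?_ ?_
      · exact (hηint.1.aemeasurable.div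
          (measurable_const.add hFcont.measurable).aemeasurable).aestronglyMeasurable.restrict
      · filter_upwards [ae_restrict_mem measurableSet_Ioc] with s hs
        have h1 : 1 ≤ 1 + (c + ∫ r in (0 : ℝ)..s, η r) := by
          linarith [hFnonneg s (Ioc_subset_Icc_self hs)]
        rw [Real.norm_eq_abs]
        change |η s / (1 + (c + ∫ r in (0 : ℝ)..s, η r))| ≤ |η s|
        rw [abs_div, abs_of_pos (show (0 : ℝ) < 1 + (c + ∫ r in (0 : ℝ)..s, η r) by linarith)]
        exact div_le_self (abs_nonneg _) h1
    -- (i) the left pairing along the characteristic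
    have hleft : ∫ t in Ioi (0 : ℝ), H₁ (shearFlow (t, zz)) =
        ∫ t in Ioi (0 : ℝ), (log (1 + c) + ∫ s in Ioc 0 t, η' s) * ρ' t := by
      refine integral_congr_ae ?_
      filter_upwards [hDu, ae_restrict_mem measurableSet_Ioi] with t ht htpos
      simp only [hH₁def]
      rcases le_or_gt t b' with htb | htb
      · have htI : t ∈ Icc 0 b' := ⟨le_of_lt htpos, htb⟩
        congr 1
        rw [ht, ← hprim t htI, hlog t htI, intervalIntegral.integral_of_le htI.1]
      · have h0 : DΦ (shearFlow (t, zz)) = 0 := hρ'b t htb.le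
        have h0' : ρ' t = 0 := hρ'b t htb.le
        rw [h0, h0', mul_zero, mul_zero]
    -- (ii) integration by parts
    have hparts := integral_Ioi_primitive_mul_deriv (c := log (1 + c)) hb' hη'int hρ hρ'c hρb
      hρ'b hρ0
    -- (iii) the right pairing along the characteristic
    have hright : ∫ t in Ioi (0 : ℝ), η' t * ρ t = ∫ t in Ioi (0 : ℝ), H₂ (shearFlow (t, zz)) := by
      refine integral_congr_ae ?_
      filter_upwards [hDu, ae_restrict_mem measurableSet_Ioi] with t ht htpos
      simp only [hH₂def]
      rcases le_or_gt t b' with htb | htb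
      · have htI : t ∈ Icc 0 b' := ⟨le_of_lt htpos, htb⟩
        have hηt : η t = Qc (shearFlow (t, zz)) := by
          simp only [hηdef, indicator_of_mem (show t ∈ Ioc 0 b' from ⟨htpos, htb⟩), hqdef]
        have hη't : η' t = Qc (shearFlow (t, zz)) / (1 + F3 (shearFlow (t, zz))) := by
          change η t / (1 + (c + ∫ r in (0 : ℝ)..t, η r)) = _
          rw [hηt, hprim t htI, ← ht]
        rw [hη't]
      · have h0 : Φ (shearFlow (t, zz)) = 0 := hρb t htb.le
        have h0' : ρ t = 0 := hρb t htb.le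
        rw [h0, h0', mul_zero, mul_zero]
    rw [hleft, hparts, hright]
  -- ### Step 4: conclusion
  rw [hstep1, integral_add hH₁S hH₂S, hI₁, hI₂, integral_congr_ae hchar, integral_neg]
  ring

end Main

end Literature.MathematicalPhysics.KineticTheory
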